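import Literature.Probability.RandomPlanarGeometry.SAWBendingEnergyFekete
import Literature.Probability.RandomPlanarGeometry.SAWUnfolding
import Literature.Probability.RandomPlanarGeometry.SAWBridgeRenewalEquation
import HarnessLib

/-!
# Bridges have the same bending free energy: `log Z^B_N(t)/N → κ(t)` (lane «STIFF», item F2)

Topic `Literature/Probability/RandomPlanarGeometry` (continues `SAWBendingEnergyFekete.lean` (F1: `log Z_N(t)/N → κ(t)`),
`SAWBendingEnergy.lean` (`Zd.turns`, `Zd.Zbend`, `Zd.ZbendB`, `Zd.bendFE`, `wturns`, `turns_traj`), `SAWUnfolding.lean` /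
`SAWUnfoldingStep.lean` (the Hammersley–Welsh unfolding `Zd.unfoldStep`, `Zd.unfold`, `Zd.code`, `Zd.unfold_code_injOn`),
`SAWBridges.lean` (the split `Zd.headWalk` / `Zd.tailWalk` at the last minimum), `SAWWords.lean` (step words)).

Source for the mechanism: N. Madras, G. Slade, *The Self-Avoiding Walk* (1993), §3.1: the chain `c_N ≤ Σ_m h_{m+1} h_{N-m}`
(first line of (3.1.7), split at the last minimum), `h_N ≤ P_D(N) b_N` (Proposition 3.1.5, unfolding with the code of
decreasing increments), `b_a b_b ≤ b_{a+b}` ((1.2.15)), giving Corollary 3.1.6 `μ^N e^{-O(√N)} ≤ b_N`. Here the SAME three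
maps are run WITH THE BENDING WEIGHT `t^{turns}` of semi-flexible walks, by bookkeeping the turns through each map on
the step-word side:
* `wordOf_concatWalk` (`= w₁ ++ w₂`), `wordOf_tailWalk` (`= drop m w`), `wordOf_headWalk` (`= 0 :: reverse(take m w) + 2`,
  the prefix reversed and negated behind one `+e₀` step), `wordOf_unfoldStep` (`= take n₁ w ++ reflX (drop n₁ w)`: the fold
  reflects the letters after the pivot, which lies on the mirror); with `wturns_append_le` / `le_wturns_append`,
  `wturns_reverse`, `wturns_map_of_injective`: each map changes the number of turns by at most ONE per cut / fold
  (`turns_concatWalk_le_and_ge`, `turns_head_tail_le_and_ge`, `turns_unfoldStep_le_and_ge`);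
* along the full unfolding the number of folds is the size of the code, at most `√(2n)` (`turns_unfold_le_and_ge`,
  `card_effective_le_card_code`, `card_code_le_sqrt` via `card_mul_succ_le_two_mul_sum`);
* hence, with `M = max(t, 1/t)`: **`sum_halfSpace_pow_turns_le`** `Z^H_n(t) ≤ M^{√(2n)} · #{codes} · Z^B_n(t)` (weighted
  Proposition 3.1.5), **`Zbend_le_sum_halfSpace`** `Z_n(t) ≤ M Σ_m Z^H_{m+1}(t) Z^H_{n-m}(t)` (weighted (3.1.7)),
  **`ZbendB_mul_le`** `Z^B_a Z^B_b ≤ M Z^B_{a+b}` (weighted (1.2.15)), and **`Zbend_le_mul_ZbendB_succ`**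
  `Z_n(t) ≤ (n+1) M² (M^{√(2(n+1))} e^{3√(n+1)})² Z^B_{n+1}(t)` (weighted (3.1.7) / Corollary 3.1.6);
* **`Zd.tendsto_log_ZbendB_div`** (F2 = the planner's `BendFE_bridges`, a-idea-2 `Sketch_v7.lean`, body verbatim): for every
  `t > 0`, `log Z^B_N(t)/N → κ(t)`, by the squeeze `e^{-o(N)} Z_{N-1}(t) ≤ Z^B_N(t) ≤ Z_N(t)` and F1.
Printed status: the unweighted chain is M–S §3.1; the turn bookkeeping and the weighted statements are this file's
(no bending-weighted Hammersley–Welsh bound located in print: lane «pcv-sawmu» route «STIFF» §37, REPORT sentence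
"walks = bridges for κ"). One definition: `Step.reflX` (the letter reflection `0 ↔ 2`). Everything on `ℤ²`.
Tree-twin search: stems `ZbendB`, `wordOf_unfoldStep`, `turns_unfold`, `reflX` → none outside `SAWBendingEnergy*.lean`. No twin.
-/

noncomputable section

open Finset Filter Topology
open scoped BigOperators
open Literature.Probability.LatticeModels Literature.Probability.Percolation

namespace Literature.Probability.RandomPlanarGeometry.SAW

/-! ### Letter maps and the turn count -/

/-- An injective relabelling of the letters preserves the number of turns (a `private` copy of
`SAWBendingBlockRenewal.wturns_map`, kept local to avoid importing that file's dependencies). [folklore] -/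
private theorem wturns_map_of_injective {f : Step → Step} (hf : Function.Injective f) : ∀ w : List Step, wturns (w.map f) = wturns w
  | [] => by simp
  | [a] => by simp
  | a :: b :: w => by
    have ih := wturns_map_of_injective hf (b :: w)
    simp only [List.map_cons, wturns_cons_cons] at ih ⊢
    rw [ih]
    by_cases hab : a = b
    · subst hab; simp
    · simp [hab, hf.ne hab]

/-- Appending one letter after a word ending in `b` adds the turn `[b ≠ a]`. [cite: MadrasSlade1993, §1.1 (step words of walks; elementary)] -/
theorem wturns_append_append_singleton : ∀ (u : List Step) (b a : Step),
    wturns (u ++ [b] ++ [a]) = wturns (u ++ [b]) + (if b = a then 0 else 1)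
  | [], b, a => by simp
  | [c], b, a => by simp
  | c :: e :: u, b, a => by
    have ih := wturns_append_append_singleton (e :: u) b a
    simp only [List.cons_append, wturns_cons_cons] at ih ⊢
    rw [ih]
    ring

/-- **Reversal preserves the number of turns.** [cite: MadrasSlade1993, §1.1 (step words of walks; elementary)] -/
theorem wturns_reverse : ∀ w : List Step, wturns w.reverse = wturns w
  | [] => by simp
  | [a] => by simp
  | a :: b :: w => by
    have ih := wturns_reverse (b :: w)
    rw [List.reverse_cons, List.reverse_cons, wturns_append_append_singleton, ← List.reverse_cons, ih,
      wturns_cons_cons]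
    by_cases h : a = b
    · simp [h]
    · rw [if_neg h, if_neg (Ne.symm h)]; ring

namespace Step

/-- `ofStep x (x + vec a) = a`. [cite: MadrasSlade1993, §1.1 (step words of walks; elementary)] -/
theorem ofStep_add_vec (x : Site 2) (a : Step) : ofStep x (x + vec a) = a := by
  have h := eq_add_vec_ofStep (adj_add_vec x a)
  exact (vec_injective (add_left_cancel h)).symm

/-- `vec 0 = e₀ = Pi.single 0 1`. [cite: MadrasSlade1993, §1.1 (step words of walks; elementary)] -/
theorem vec_zero_eq_single : vec 0 = Pi.single 0 1 := by
  funext j; fin_cases j <;> simp [vec, dx, dy]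

/-- Opposite letters: `vec (a + 2) = -vec a`. [cite: MadrasSlade1993, §1.1 (step words of walks; elementary)] -/
theorem vec_add_two' (a : Step) : vec (a + 2) = -vec a := by
  fin_cases a <;> (ext j; fin_cases j <;> rfl)

/-- The reflection of the letters in a vertical line (`x₀ ↦ -x₀`): `0 ↔ 2`, `1, 3` fixed. [folklore] -/
def reflX (a : Step) : Step := if a = 0 then 2 else if a = 2 then 0 else a

/-- `reflX` is injective. [cite: MadrasSlade1993, §3.1 (reflection in the hyperplane x₁ = A₁)] -/
theorem reflX_injective : Function.Injective reflX := by
  unfold Function.Injective reflX; decide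

/-- `reflX` negates the first component of the step. [cite: MadrasSlade1993, §3.1 (reflection in the hyperplane x₁ = A₁)] -/
theorem dx_reflX : ∀ a : Step, dx (reflX a) = -dx a := by decide

/-- `reflX` keeps the second component of the step. [cite: MadrasSlade1993, §3.1 (reflection in the hyperplane x₁ = A₁)] -/
theorem dy_reflX : ∀ a : Step, dy (reflX a) = dy a := by decide

/-- The reflection of the first coordinate acts on steps by `reflX`:
`reflCoord ℓ (x + vec a) = reflCoord ℓ x + vec (reflX a)`. [cite: MadrasSlade1993, §3.1 (reflection in the hyperplane x₁ = A₁)] -/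
theorem reflCoord_add_vec (ℓ : ℤ) (x : Site 2) (a : Step) :
    Zd.reflCoord ℓ (x + vec a) = Zd.reflCoord ℓ x + vec (reflX a) := by
  funext j
  by_cases hj : j = 0
  · subst hj
    simp only [Zd.reflCoord_apply_zero, Pi.add_apply, vec_apply_zero, dx_reflX]
    ring
  · rw [Zd.reflCoord_apply_of_ne _ _ hj, Pi.add_apply, Pi.add_apply, Zd.reflCoord_apply_of_ne _ _ hj]
    have hj1 : j = 1 := by
      fin_cases j
      · exact absurd rfl hj
      · rfl
    subst hj1
    simp only [vec_apply_one, dy_reflX]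

end Step

/-! ### Reading step words off transformed walks -/

/-- **Criterion for the step word**: if `ξ(i+1) = ξ(i) + e_{W[i]}` for all `i < N` then `wordOf N ξ = W`.
[cite: MadrasSlade1993, §1.1 (step words of walks; elementary)] -/
theorem wordOf_eq_of_steps {N : ℕ} {ξ : ℕ → Site 2} {W : List Step} (hlen : W.length = N)
    (hstep : ∀ (i : ℕ) (hi : i < N), ξ (i + 1) = ξ i + Step.vec (W[i]'(by omega))) : wordOf N ξ = W := by
  refine List.ext_getElem (by simp [hlen]) fun i h1 h2 => ?_
  have hi : i < N := by simpa using h1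
  simp only [wordOf, List.getElem_ofFn]
  rw [hstep i hi, Step.ofStep_add_vec]

/-- The steps of a self-avoiding walk are read off its word: `ω(i+1) = ω(i) + e_{(wordOf n ω)[i]}`.
[cite: MadrasSlade1993, §1.1 (step words of walks; elementary)] -/
theorem apply_succ_eq_add_vec_wordOf {n : ℕ} {ω : ℕ → Site 2} (hω : ω ∈ Zd.saws 2 n) {i : ℕ} (hi : i < n) :
    ω (i + 1) = ω i + Step.vec ((wordOf n ω)[i]'(by simp [hi])) := by
  have h := Step.eq_add_vec_ofStep ((Zd.mem_saws.1 hω).2.2.1 i hi)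
  simp only [wordOf, List.getElem_ofFn]
  exact h

/-- `turns` of a self-avoiding walk is `wturns` of its word. [cite: MadrasSlade1993, §1.1] -/
theorem turns_eq_wturns_wordOf {n : ℕ} {ω : ℕ → Site 2} (hω : ω ∈ Zd.saws 2 n) :
    Zd.turns n ω = wturns (wordOf n ω) := by
  conv_lhs => rw [← traj_wordOf hω]
  exact turns_traj (length_wordOf n ω)

/-- **Word of a concatenation**: `wordOf (a+b) (η ⊕ τ) = wordOf a η ++ wordOf b τ` (`τ 0 = 0`).
[cite: MadrasSlade1993, §1.2, eq. (1.2.15)] -/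
theorem wordOf_concatWalk {a b : ℕ} {η τ : ℕ → Site 2} (hη : η ∈ Zd.saws 2 a) (hτ : τ ∈ Zd.saws 2 b) :
    wordOf (a + b) (Zd.concatWalk a η τ) = wordOf a η ++ wordOf b τ := by
  have hτ0 : τ 0 = 0 := (Zd.mem_saws.1 hτ).1
  refine wordOf_eq_of_steps (by simp) fun i hi => ?_
  rcases lt_or_ge i a with hia | hia
  · rw [Zd.concatWalk_apply_of_le _ _ hia.le, Zd.concatWalk_apply_of_le _ _ (Nat.succ_le_of_lt hia),
      List.getElem_append_left (by simpa using hia), apply_succ_eq_add_vec_wordOf hη hia]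
  · obtain ⟨j, rfl⟩ : ∃ j, i = a + j := ⟨i - a, by omega⟩
    have hj : j < b := by omega
    rw [show a + j + 1 = a + (j + 1) by ring, Zd.concatWalk_apply_add _ _ hτ0, Zd.concatWalk_apply_add _ _ hτ0,
      List.getElem_append_right (by simp), apply_succ_eq_add_vec_wordOf hτ hj, add_assoc]
    congr 2
    simp

/-- **Word of the tail piece** (after the last minimum `m` of the first coordinate): `(wordOf n ω).drop m`.
[cite: MadrasSlade1993, §3.1, proof of Theorem 3.1.1] -/
theorem wordOf_tailWalk {n : ℕ} {ω : ℕ → Site 2} (hω : ω ∈ Zd.saws 2 n) :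
    wordOf (n - Zd.lastMin n ω) (Zd.tailWalk n ω) = (wordOf n ω).drop (Zd.lastMin n ω) := by
  set m := Zd.lastMin n ω with hm
  have hmn : m ≤ n := Zd.lastMin_le n ω
  refine wordOf_eq_of_steps (by simp) fun i hi => ?_
  rw [Zd.tailWalk_apply hm.symm, Zd.tailWalk_apply hm.symm, min_eq_left (by omega : i + 1 ≤ n - m),
    min_eq_left (by omega : i ≤ n - m), show m + (i + 1) = m + i + 1 by ring,
    apply_succ_eq_add_vec_wordOf hω (show m + i < n by omega), List.getElem_drop]
  abel

/-- **Word of the head piece** (up to the last minimum `m`, reversed, preceded by a step `+e₀`):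
`0 :: ((wordOf n ω).take m).reverse.map (· + 2)`. [cite: MadrasSlade1993, §3.1, proof of Theorem 3.1.1] -/
theorem wordOf_headWalk {n : ℕ} {ω : ℕ → Site 2} (hω : ω ∈ Zd.saws 2 n) :
    wordOf (Zd.lastMin n ω + 1) (Zd.headWalk n ω) =
      (0 : Step) :: (((wordOf n ω).take (Zd.lastMin n ω)).reverse.map fun a => a + 2) := by
  set m := Zd.lastMin n ω with hm
  have hmn : m ≤ n := Zd.lastMin_le n ω
  refine wordOf_eq_of_steps (by simp [min_eq_left hmn]) fun i hi => ?_
  rcases Nat.eq_zero_or_pos i with rfl | hipos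
  · rw [Zd.headWalk_apply hm.symm, Zd.headWalk_apply hm.symm, if_neg (by omega), if_pos rfl,
      min_eq_left (by omega : 1 ≤ m + 1), Nat.add_sub_cancel, sub_self, zero_add, zero_add]
    simp [Step.vec_zero_eq_single]
  · rw [Zd.headWalk_apply hm.symm, Zd.headWalk_apply hm.symm, if_neg (by omega), if_neg (by omega),
      min_eq_left (by omega : i + 1 ≤ m + 1), min_eq_left (by omega : i ≤ m + 1),
      show m + 1 - (i + 1) = m - i by omega, show m + 1 - i = m - i + 1 by omega,
      apply_succ_eq_add_vec_wordOf hω (show m - i < n by omega)]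
    have hidx : ((0 : Step) :: (((wordOf n ω).take m).reverse.map fun a => a + 2))[i]'(by
        simp [min_eq_left hmn]; omega) = (wordOf n ω)[m - i]'(by simp; omega) + 2 := by
      rw [List.getElem_cons]
      simp only [hipos.ne', dite_false, List.getElem_map, List.getElem_reverse, List.length_take,
        length_wordOf, min_eq_left hmn, List.getElem_take]
      congr 2
      omega
    rw [hidx, Step.vec_add_two']
    abel

/-- **Word of the unfolding step**: reflecting after the pivot `p = n₁` (which lies on the mirror) keeps the
first `p` letters and reflects the others: `wordOf n (unfoldStep n ω) = take p w ++ (drop p w).map reflX`.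
[cite: MadrasSlade1993, §3.1, proof of Proposition 3.1.5] -/
theorem wordOf_unfoldStep {n : ℕ} {ω : ℕ → Site 2} (hω : ω ∈ Zd.saws 2 n) :
    wordOf n (Zd.unfoldStep n ω) =
      (wordOf n ω).take (Zd.lastArgmax n ω) ++ ((wordOf n ω).drop (Zd.lastArgmax n ω)).map Step.reflX := by
  obtain ⟨hpn, hpmax⟩ := Zd.lastArgmax_spec n ω
  set p := Zd.lastArgmax n ω with hp
  set ℓ := Zd.maxLevel n ω with hℓ
  have hfix : Zd.reflCoord ℓ (ω p) = ω p := (Zd.reflCoord_eq_self_iff ℓ (ω p)).2 hpmax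
  have hrefl : ∀ i, p ≤ i → Zd.unfoldStep n ω i = Zd.reflCoord ℓ (ω i) := by
    intro i hi
    rcases hi.eq_or_lt with h | h
    · rw [← h, Zd.unfoldStep_of_le ω le_rfl, hfix]
    · show Zd.reflectFrom ℓ p ω i = _
      exact Zd.reflectFrom_of_lt ω h
  refine wordOf_eq_of_steps (by simp; omega) fun i hi => ?_
  rcases lt_or_ge i p with hip | hip
  · rw [Zd.unfoldStep_of_le ω hip.le, Zd.unfoldStep_of_le ω (Nat.succ_le_of_lt hip),
      List.getElem_append_left (by simpa using And.intro hip hi), apply_succ_eq_add_vec_wordOf hω hi]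
    congr 2
    simp [List.getElem_take]
  · rw [hrefl (i + 1) (by omega), hrefl i hip, apply_succ_eq_add_vec_wordOf hω hi, Step.reflCoord_add_vec,
      List.getElem_append_right (by simpa using Or.inl hip)]
    congr 2
    simp only [List.getElem_map, List.getElem_drop, List.length_take, length_wordOf, min_eq_left hpn]
    congr 2
    omega

/-! ### Turn bookkeeping for the three maps of the Hammersley–Welsh chain -/

/-- **The unfolding step changes the number of turns by at most one** (only the turn at the pivot).
[cite: MadrasSlade1993, §3.1, proof of Proposition 3.1.5 (turn bookkeeping, this file)] -/
theorem turns_unfoldStep_le_and_ge {n : ℕ} {ω : ℕ → Site 2} (hω : ω ∈ Zd.saws 2 n) :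
    Zd.turns n (Zd.unfoldStep n ω) ≤ Zd.turns n ω + 1 ∧ Zd.turns n ω ≤ Zd.turns n (Zd.unfoldStep n ω) + 1 := by
  rw [turns_eq_wturns_wordOf hω, turns_eq_wturns_wordOf (Zd.unfoldStep_mem_saws hω), wordOf_unfoldStep hω]
  set u := (wordOf n ω).take (Zd.lastArgmax n ω)
  set v := (wordOf n ω).drop (Zd.lastArgmax n ω)
  have hw : wordOf n ω = u ++ v := (List.take_append_drop _ _).symm
  rw [hw]
  have h1 := wturns_append_le u (v.map Step.reflX)
  have h2 := le_wturns_append u (v.map Step.reflX)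
  have h3 := wturns_append_le u v
  have h4 := le_wturns_append u v
  rw [wturns_map_of_injective Step.reflX_injective] at h1 h2
  omega

/-- **Concatenation creates at most one turn (at the junction) and destroys none.**
[cite: MadrasSlade1993, §1.2, eq. (1.2.15) (turn bookkeeping, this file)] -/
theorem turns_concatWalk_le_and_ge {a b : ℕ} {η τ : ℕ → Site 2} (hη : η ∈ Zd.saws 2 a) (hτ : τ ∈ Zd.saws 2 b)
    (hc : Zd.concatWalk a η τ ∈ Zd.saws 2 (a + b)) :
    Zd.turns (a + b) (Zd.concatWalk a η τ) ≤ Zd.turns a η + Zd.turns b τ + 1 ∧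
      Zd.turns a η + Zd.turns b τ ≤ Zd.turns (a + b) (Zd.concatWalk a η τ) := by
  rw [turns_eq_wturns_wordOf hη, turns_eq_wturns_wordOf hτ, turns_eq_wturns_wordOf hc, wordOf_concatWalk hη hτ]
  exact ⟨wturns_append_le _ _, le_wturns_append _ _⟩

/-- **Splitting at the last minimum changes the number of turns by at most one**: with the head piece `H`
(reversed prefix plus one step) and the tail piece `T`, `|turns ω - (turns H + turns T)| ≤ 1`.
[cite: MadrasSlade1993, §3.1, proof of Theorem 3.1.1 (turn bookkeeping, this file)] -/
theorem turns_head_tail_le_and_ge {n : ℕ} {ω : ℕ → Site 2} (hω : ω ∈ Zd.saws 2 n) :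
    Zd.turns (Zd.lastMin n ω + 1) (Zd.headWalk n ω) + Zd.turns (n - Zd.lastMin n ω) (Zd.tailWalk n ω) ≤
        Zd.turns n ω + 1 ∧
      Zd.turns n ω ≤
        Zd.turns (Zd.lastMin n ω + 1) (Zd.headWalk n ω) + Zd.turns (n - Zd.lastMin n ω) (Zd.tailWalk n ω) + 1 := by
  have hH := (Zd.mem_halfSpaceWalks.1 (Zd.headWalk_mem hω)).1
  have hT := (Zd.mem_halfSpaceWalks.1 (Zd.tailWalk_mem hω)).1
  rw [turns_eq_wturns_wordOf hω, turns_eq_wturns_wordOf hH, turns_eq_wturns_wordOf hT, wordOf_headWalk hω,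
    wordOf_tailWalk hω]
  set u := (wordOf n ω).take (Zd.lastMin n ω)
  set v := (wordOf n ω).drop (Zd.lastMin n ω)
  have hw : wordOf n ω = u ++ v := (List.take_append_drop _ _).symm
  rw [hw]
  have h1 := wturns_cons_le (0 : Step) ((u.reverse.map fun a => a + 2))
  have h2 := wturns_le_wturns_cons (0 : Step) ((u.reverse.map fun a => a + 2))
  have hinj : Function.Injective fun a : Step => a + 2 := fun a b h => by simpa using h
  rw [wturns_map_of_injective hinj, wturns_reverse] at h1 h2
  have h3 := wturns_append_le u v
  have h4 := le_wturns_append u v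
  omega


/-! ### The weight bookkeeping lemma -/

/-- If `|a - b| ≤ c` then `t^a ≤ max(t, t⁻¹)^c · t^b` (`t > 0`). [cite: MadrasSlade1993, §1.2, eq. (1.2.3) (weighted form; elementary)] -/
theorem pow_le_maxInv_pow_mul_pow {t : ℝ} (ht : 0 < t) {a b c : ℕ} (h1 : a ≤ b + c) (h2 : b ≤ a + c) :
    t ^ a ≤ max t t⁻¹ ^ c * t ^ b := by
  have hM1 : 1 ≤ max t t⁻¹ := by
    rcases le_or_gt 1 t with h | h
    · exact h.trans (le_max_left _ _)
    · exact (one_le_inv₀ ht |>.2 h.le).trans (le_max_right _ _)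
  have hMt : t ≤ max t t⁻¹ := le_max_left _ _
  have hMi : t⁻¹ ≤ max t t⁻¹ := le_max_right _ _
  have hM0 : 0 < max t t⁻¹ := lt_of_lt_of_le one_pos hM1
  rcases le_or_gt b a with hab | hab
  · -- `a = b + (a - b)`, `a - b ≤ c`
    obtain ⟨e, rfl⟩ := Nat.exists_eq_add_of_le hab
    rw [pow_add, mul_comm]
    apply mul_le_mul_of_nonneg_right _ (pow_nonneg ht.le _)
    calc t ^ e ≤ max t t⁻¹ ^ e := pow_le_pow_left₀ ht.le hMt e
      _ ≤ max t t⁻¹ ^ c := pow_le_pow_right₀ hM1 (by omega)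
  · -- `b = a + e`, `e ≤ c`: `t^a = t^b · (t⁻¹)^e`
    obtain ⟨e, rfl⟩ := Nat.exists_eq_add_of_le hab.le
    have : t ^ a = t ^ (a + e) * t⁻¹ ^ e := by
      rw [pow_add, mul_assoc, ← mul_pow, mul_inv_cancel₀ ht.ne', one_pow, mul_one]
    rw [this, mul_comm]
    apply mul_le_mul_of_nonneg_right _ (pow_nonneg ht.le _)
    calc t⁻¹ ^ e ≤ max t t⁻¹ ^ e := pow_le_pow_left₀ (inv_pos.2 ht).le hMi e
      _ ≤ max t t⁻¹ ^ c := pow_le_pow_right₀ hM1 (by omega)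

namespace Zd

/-! ### Iterating: the number of turns changes by at most the number of folds -/

open Classical in
/-- Along `k` unfolding steps the number of turns changes by at most the number of EFFECTIVE steps.
[cite: MadrasSlade1993, §3.1, proof of Proposition 3.1.5 (turn bookkeeping, this file)] -/
theorem turns_iterate_unfoldStep {n : ℕ} {ω : ℕ → Site 2} (hω : ω ∈ saws 2 n) (k : ℕ) :
    turns n ((unfoldStep n)^[k] ω) ≤ turns n ω +
        ((Finset.range k).filter fun i => (unfoldStep n)^[i + 1] ω ≠ (unfoldStep n)^[i] ω).card ∧
      turns n ω ≤ turns n ((unfoldStep n)^[k] ω) +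
        ((Finset.range k).filter fun i => (unfoldStep n)^[i + 1] ω ≠ (unfoldStep n)^[i] ω).card := by
  induction k with
  | zero => simp
  | succ k ih =>
    have hk := iterate_unfoldStep_mem_saws hω k
    have hnot : k ∉ (Finset.range k).filter fun i => (unfoldStep n)^[i + 1] ω ≠ (unfoldStep n)^[i] ω := by
      simp
    have e : (unfoldStep n)^[k + 1] ω = unfoldStep n ((unfoldStep n)^[k] ω) :=
      Function.iterate_succ_apply' _ _ _
    rw [Finset.range_add_one, Finset.filter_insert, e]
    by_cases heff : unfoldStep n ((unfoldStep n)^[k] ω) ≠ (unfoldStep n)^[k] ω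
    · rw [if_pos heff, Finset.card_insert_of_notMem hnot]
      have h1 := turns_unfoldStep_le_and_ge hk
      omega
    · rw [if_neg heff]
      rw [not_not] at heff
      rw [heff]
      exact ih

open Classical in
/-- An effective step has a positive increment of the maximum. [cite: MadrasSlade1993, §3.1, proof of Proposition 3.1.5] -/
theorem incr_pos_of_ne {n : ℕ} {ω : ℕ → Site 2} (hω : ω ∈ saws 2 n) {i : ℕ}
    (h : (unfoldStep n)^[i + 1] ω ≠ (unfoldStep n)^[i] ω) : 0 < incr n ω i := by
  have hi := iterate_unfoldStep_mem_saws hω i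
  rw [Function.iterate_succ_apply'] at h
  have hmove : lastArgmax n ((unfoldStep n)^[i] ω) < n := by
    by_contra hge
    exact h ((unfoldStep_eq_self_iff hi).2 (le_antisymm (lastArgmax_spec _ _).1 (Nat.le_of_not_lt hge)))
  have hlt := maxLevel_lt_maxLevel_unfoldStep hmove
  rw [incr, increment]
  have : 0 < maxLevel n (unfoldStep n ((unfoldStep n)^[i] ω)) - maxLevel n ((unfoldStep n)^[i] ω) := by linarith
  exact Int.lt_toNat.2 (by simpa using this)

/-- The increments strictly decrease while positive: for `i < j` with `incr j > 0`, `incr j < incr i`.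
[cite: MadrasSlade1993, §3.1, proof of Proposition 3.1.5 ("A₁ > A₂ > ⋯")] -/
theorem incr_lt_of_lt {n : ℕ} {ω : ℕ → Site 2} (hω : ω ∈ saws 2 n) {i j : ℕ} (hij : i < j) (hj : 0 < incr n ω j) :
    incr n ω j < incr n ω i := by
  induction hij with
  | refl => exact incr_succ_lt hω hj
  | step hle ih =>
    rename_i j
    have h1 := incr_succ_lt hω hj
    exact h1.trans (ih (lt_trans hj h1))

open Classical in
/-- **The number of effective steps is at most the size of the code** (the positive increments are pairwise
distinct, and the code is their set). [cite: MadrasSlade1993, §3.1, proof of Proposition 3.1.5] -/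
theorem card_effective_le_card_code {n : ℕ} {ω : ℕ → Site 2} (hω : ω ∈ saws 2 n) :
    ((Finset.range (n + 1)).filter fun i => (unfoldStep n)^[i + 1] ω ≠ (unfoldStep n)^[i] ω).card ≤
      (code n ω).card := by
  set P := (Finset.range (n + 1)).filter fun i => 0 < incr n ω i with hP
  have hsub : ((Finset.range (n + 1)).filter fun i => (unfoldStep n)^[i + 1] ω ≠ (unfoldStep n)^[i] ω) ⊆ P := by
    intro i hi
    rw [Finset.mem_filter] at hi ⊢
    exact ⟨hi.1, incr_pos_of_ne hω hi.2⟩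
  refine (Finset.card_le_card hsub).trans (le_of_eq ?_)
  -- `code = incr '' P`, injectively
  have himg : P.image (incr n ω) = code n ω := by
    ext x
    simp only [hP, code, Finset.mem_image, Finset.mem_filter, Finset.mem_erase, Finset.mem_range]
    constructor
    · rintro ⟨i, ⟨hi, hpos⟩, rfl⟩
      exact ⟨by omega, i, hi, rfl⟩
    · rintro ⟨hx, i, hi, rfl⟩
      exact ⟨i, ⟨hi, Nat.pos_of_ne_zero hx⟩, rfl⟩
  rw [← himg, Finset.card_image_of_injOn]
  intro i hi j hj h
  rw [Finset.mem_coe, hP, Finset.mem_filter] at hi hj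
  by_contra hne
  rcases lt_or_gt_of_ne hne with hlt | hlt
  · have := incr_lt_of_lt hω hlt hj.2; omega
  · have := incr_lt_of_lt hω hlt hi.2; omega

/-- **A set of positive integers with sum `≤ n` has `k` elements with `k(k+1) ≤ 2n`** (its elements dominate
`1, 2, …, k`). [cite: MadrasSlade1993, §3.1, eq. (3.1.5) (distinct parts; elementary)] -/
theorem card_mul_succ_le_two_mul_sum {S : Finset ℕ} (hS : ∀ s ∈ S, 1 ≤ s) :
    S.card * (S.card + 1) ≤ 2 * S.sum id := by
  induction S using Finset.induction_on_max with
  | empty => simp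
  | insert a S hlt ih =>
    have haS : a ∉ S := fun h => lt_irrefl a (hlt a h)
    have hS' : ∀ s ∈ S, 1 ≤ s := fun s hs => hS s (Finset.mem_insert_of_mem hs)
    have ha1 : 1 ≤ a := hS a (Finset.mem_insert_self a S)
    have ih' := ih hS'
    -- `S ⊆ {1, …, a-1}`, so `card S ≤ a - 1`
    have hcard : S.card ≤ a - 1 := by
      have hsub : S ⊆ Finset.Ioo 0 a := fun s hs => Finset.mem_Ioo.2 ⟨hS' s hs, hlt s hs⟩
      have := Finset.card_le_card hsub
      simpa using this
    have hcard' : S.card + 1 ≤ a := by omega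
    rw [Finset.card_insert_of_notMem haS, Finset.sum_insert haS, id]
    nlinarith [ih', hcard']

/-- **The code has at most `√(2n)` elements.** [cite: MadrasSlade1993, §3.1, proof of Proposition 3.1.5] -/
theorem card_code_le_sqrt {n : ℕ} {ω : ℕ → Site 2} (hω : ω ∈ saws 2 n) :
    ((code n ω).card : ℝ) ≤ Real.sqrt (2 * n) := by
  have hmem := code_mem_finsetsOfSumLE hω
  rw [Literature.Combinatorics.Enumerative.mem_finsetsOfSumLE] at hmem
  have h := card_mul_succ_le_two_mul_sum hmem.1
  have h2 : (code n ω).card * ((code n ω).card + 1) ≤ 2 * n := h.trans (by omega)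
  refine Real.le_sqrt_of_sq_le ?_
  have : ((code n ω).card : ℝ) * ((code n ω).card + 1) ≤ 2 * n := by exact_mod_cast h2
  nlinarith

/-- **Turns before and after the full unfolding differ by at most `#code ≤ √(2n)`.**
[cite: MadrasSlade1993, §3.1, proof of Proposition 3.1.5 (turn bookkeeping, this file)] -/
theorem turns_unfold_le_and_ge {n : ℕ} {ω : ℕ → Site 2} (hω : ω ∈ saws 2 n) :
    turns n (unfold n ω) ≤ turns n ω + (code n ω).card ∧ turns n ω ≤ turns n (unfold n ω) + (code n ω).card := by
  classical
  have h1 := turns_iterate_unfoldStep hω (n + 1)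
  have h2 := card_effective_le_card_code hω
  rw [unfold]
  omega

/-! ### The weighted Hammersley–Welsh unfolding bound -/

/-- **Weighted unfolding**: for `t > 0`,
`Σ_{ω ∈ H_n} t^{turns ω} ≤ max(t,1/t)^{√(2n)} · #{codes} · Σ_{β ∈ B_n} t^{turns β}`: half-space walks unfold into
bridges at most `#{codes}`-to-one (`unfold_code_injOn`), and each unfolding moves the turn count by at most
`√(2n)`. [cite: MadrasSlade1993, Proposition 3.1.5 (weighted by the bending fugacity, this file)] -/
theorem sum_halfSpace_pow_turns_le (n : ℕ) {t : ℝ} (ht : 0 < t) :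
    ∑ ω ∈ halfSpaceWalks 2 n, t ^ turns n ω ≤
      max t t⁻¹ ^ Real.sqrt (2 * n) * (Literature.Combinatorics.Enumerative.finsetsOfSumLE n).card *
        ∑ β ∈ bridges 2 n, t ^ turns n β := by
  classical
  set M := max t t⁻¹ with hM
  have hM1 : 1 ≤ M := by
    rcases le_or_gt 1 t with h | h
    · exact h.trans (le_max_left _ _)
    · exact (one_le_inv₀ ht |>.2 h.le).trans (le_max_right _ _)
  have hM0 : 0 ≤ M := zero_le_one.trans hM1
  set s := Real.sqrt (2 * n) with hs
  have hHs : halfSpaceWalks 2 n ⊆ saws 2 n := fun ω hω => (mem_halfSpaceWalks.1 hω).1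
  -- termwise
  have hterm : ∀ ω ∈ halfSpaceWalks 2 n, t ^ turns n ω ≤ M ^ s * t ^ turns n (unfold n ω) := by
    intro ω hω
    have hωs := hHs hω
    obtain ⟨h1, h2⟩ := turns_unfold_le_and_ge hωs
    have h3 : t ^ turns n ω ≤ M ^ (code n ω).card * t ^ turns n (unfold n ω) :=
      pow_le_maxInv_pow_mul_pow ht h2 h1
    refine h3.trans (mul_le_mul_of_nonneg_right ?_ (pow_nonneg ht.le _))
    rw [← Real.rpow_natCast]
    exact Real.rpow_le_rpow_of_exponent_le hM1 (card_code_le_sqrt hωs)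
  -- the injection `ω ↦ (unfold ω, code ω)`
  set F : (ℕ → Site 2) × Finset ℕ → ℝ := fun q => t ^ turns n q.1 with hF
  have hF0 : ∀ q, 0 ≤ F q := fun q => pow_nonneg ht.le _
  have hinj : Set.InjOn (fun ω : ℕ → Site 2 => (unfold n ω, code n ω)) ↑(halfSpaceWalks 2 n) :=
    fun ω hω ω' hω' h => unfold_code_injOn n (hHs hω) (hHs hω') h
  have hmaps : (halfSpaceWalks 2 n).image (fun ω : ℕ → Site 2 => (unfold n ω, code n ω)) ⊆
      bridges 2 n ×ˢ Literature.Combinatorics.Enumerative.finsetsOfSumLE n := by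
    intro q hq
    obtain ⟨ω, hω, rfl⟩ := Finset.mem_image.1 hq
    exact Finset.mem_product.2 ⟨unfold_mem_bridges hω, code_mem_finsetsOfSumLE (hHs hω)⟩
  have hsum : ∑ ω ∈ halfSpaceWalks 2 n, t ^ turns n (unfold n ω) ≤
      ((Literature.Combinatorics.Enumerative.finsetsOfSumLE n).card : ℝ) * ∑ β ∈ bridges 2 n, t ^ turns n β := by
    calc ∑ ω ∈ halfSpaceWalks 2 n, t ^ turns n (unfold n ω)
        = ∑ ω ∈ halfSpaceWalks 2 n, F ((fun ω : ℕ → Site 2 => (unfold n ω, code n ω)) ω) := rfl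
      _ = ∑ q ∈ (halfSpaceWalks 2 n).image (fun ω : ℕ → Site 2 => (unfold n ω, code n ω)), F q := by
          rw [Finset.sum_image hinj]
      _ ≤ ∑ q ∈ bridges 2 n ×ˢ Literature.Combinatorics.Enumerative.finsetsOfSumLE n, F q :=
          Finset.sum_le_sum_of_subset_of_nonneg hmaps fun q _ _ => hF0 q
      _ = ∑ β ∈ bridges 2 n, ∑ _c ∈ Literature.Combinatorics.Enumerative.finsetsOfSumLE n, t ^ turns n β := by
          rw [Finset.sum_product]
      _ = _ := by
          rw [Finset.mul_sum]
          refine Finset.sum_congr rfl fun β _ => ?_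
          rw [Finset.sum_const, nsmul_eq_mul]
  calc ∑ ω ∈ halfSpaceWalks 2 n, t ^ turns n ω
      ≤ ∑ ω ∈ halfSpaceWalks 2 n, M ^ s * t ^ turns n (unfold n ω) := Finset.sum_le_sum hterm
    _ = M ^ s * ∑ ω ∈ halfSpaceWalks 2 n, t ^ turns n (unfold n ω) := by rw [Finset.mul_sum]
    _ ≤ M ^ s * (((Literature.Combinatorics.Enumerative.finsetsOfSumLE n).card : ℝ) *
          ∑ β ∈ bridges 2 n, t ^ turns n β) :=
        mul_le_mul_of_nonneg_left hsum (Real.rpow_nonneg hM0 _)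
    _ = _ := by ring


/-! ### The weighted split at the last minimum and the weighted concatenation of bridges -/

open Classical in
/-- **Weighted splitting** (Madras–Slade (3.1.7), first line, with the bending weight): for `t > 0`,
`Z_n(t) ≤ max(t,1/t) · Σ_{m=0}^{n} Z^H_{m+1}(t) Z^H_{n-m}(t)`, `Z^H_k(t) = Σ_{ω ∈ H_k} t^{turns ω}`: cut at the last
minimum of the first coordinate (`headWalk`, `tailWalk`; injective given the cut time), losing or gaining at
most one turn. [cite: MadrasSlade1993, §3.1, eq. (3.1.7) (weighted by the bending fugacity, this file)] -/
theorem Zbend_le_sum_halfSpace (n : ℕ) {t : ℝ} (ht : 0 < t) :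
    Zbend n t ≤ max t t⁻¹ * ∑ m ∈ Finset.range (n + 1),
      (∑ ω ∈ halfSpaceWalks 2 (m + 1), t ^ turns (m + 1) ω) * ∑ ω ∈ halfSpaceWalks 2 (n - m), t ^ turns (n - m) ω := by
  set M := max t t⁻¹ with hM
  have hM0 : 0 ≤ M := le_trans ht.le (le_max_left _ _)
  -- the splitting map into the sigma type
  set g : (ℕ → Site 2) → (Σ _ : ℕ, (ℕ → Site 2) × (ℕ → Site 2)) :=
    fun ω => ⟨lastMin n ω, (headWalk n ω, tailWalk n ω)⟩ with hg
  set F : (Σ _ : ℕ, (ℕ → Site 2) × (ℕ → Site 2)) → ℝ :=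
    fun q => t ^ turns (q.1 + 1) q.2.1 * t ^ turns (n - q.1) q.2.2 with hF
  have hF0 : ∀ q, 0 ≤ F q := fun q => mul_nonneg (pow_nonneg ht.le _) (pow_nonneg ht.le _)
  set D := (Finset.range (n + 1)).sigma fun m => halfSpaceWalks 2 (m + 1) ×ˢ halfSpaceWalks 2 (n - m) with hD
  have hmaps : ∀ ω ∈ saws 2 n, g ω ∈ D := by
    intro ω hω
    simp only [hg, hD, Finset.mem_sigma, Finset.mem_range, Finset.mem_product]
    exact ⟨Nat.lt_succ_of_le (lastMin_le n ω), headWalk_mem hω, tailWalk_mem hω⟩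
  -- injectivity: verbatim the tree's argument behind `count_le_sum_halfSpaceCount`
  have hinj : Set.InjOn g ↑(saws 2 n) := by
    intro ω hω ω' hω' h
    rw [Finset.mem_coe] at hω hω'
    simp only [hg, Sigma.mk.inj_iff] at h
    obtain ⟨hmm, h⟩ := h
    have h' : (headWalk n ω, tailWalk n ω) = (headWalk n ω', tailWalk n ω') := eq_of_heq h
    simp only [Prod.mk.injEq] at h'
    obtain ⟨hh, htl⟩ := h'
    obtain ⟨h0, hend, hadj, hinj⟩ := mem_saws.1 hω
    obtain ⟨h0', hend', hadj', hinj'⟩ := mem_saws.1 hω'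
    obtain ⟨m, hm⟩ : ∃ m, lastMin n ω = m := ⟨_, rfl⟩
    have hm' : lastMin n ω' = m := hmm.symm.trans hm
    have hmn : m ≤ n := hm ▸ lastMin_le n ω
    have hωm : ω m = ω' m := by
      have := congrFun hh (m + 1)
      rw [headWalk_apply hm, headWalk_apply hm', if_neg (by omega), if_neg (by omega), min_self,
        Nat.sub_self, h0, h0', add_left_inj, zero_sub, zero_sub, neg_inj] at this
      exact this
    funext i
    rcases le_or_gt i m with hi | hi
    · rcases Nat.eq_zero_or_pos (m - i) with h | h
      · have : i = m := by omega
        rw [this, hωm]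
      · have := congrFun hh (m + 1 - i)
        rw [headWalk_apply hm, headWalk_apply hm', if_neg (by omega), if_neg (by omega),
          min_eq_left (by omega : m + 1 - i ≤ m + 1), show m + 1 - (m + 1 - i) = i by omega,
          hωm, add_left_inj, sub_left_inj] at this
        exact this
    · rcases le_or_gt i n with hin | hin
      · have := congrFun htl (i - m)
        rw [tailWalk_apply hm, tailWalk_apply hm', min_eq_left (by omega : i - m ≤ n - m),
          show m + (i - m) = i by omega, hωm, sub_left_inj] at this
        exact this
      · have := congrFun htl (n - m)
        rw [tailWalk_apply hm, tailWalk_apply hm', min_self, show m + (n - m) = n by omega, hωm,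
          sub_left_inj] at this
        rw [hend i hin.le, hend' i hin.le, this]
  -- termwise weight bookkeeping
  have hterm : ∀ ω ∈ saws 2 n, t ^ turns n ω ≤ M * F (g ω) := by
    intro ω hω
    obtain ⟨h1, h2⟩ := turns_head_tail_le_and_ge hω
    have h := pow_le_maxInv_pow_mul_pow ht (c := 1) h2 h1
    rw [pow_one, pow_add] at h
    simpa [hF, hg] using h
  calc Zbend n t = ∑ ω ∈ saws 2 n, t ^ turns n ω := rfl
    _ ≤ ∑ ω ∈ saws 2 n, M * F (g ω) := Finset.sum_le_sum hterm
    _ = M * ∑ q ∈ (saws 2 n).image g, F q := by rw [Finset.mul_sum, Finset.sum_image hinj]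
    _ ≤ M * ∑ q ∈ D, F q := by
        apply mul_le_mul_of_nonneg_left _ hM0
        refine Finset.sum_le_sum_of_subset_of_nonneg (fun q hq => ?_) fun q _ _ => hF0 q
        obtain ⟨ω, hω, rfl⟩ := Finset.mem_image.1 hq
        exact hmaps ω hω
    _ = M * ∑ m ∈ Finset.range (n + 1),
          (∑ ω ∈ halfSpaceWalks 2 (m + 1), t ^ turns (m + 1) ω) *
            ∑ ω ∈ halfSpaceWalks 2 (n - m), t ^ turns (n - m) ω := by
        rw [hD, Finset.sum_sigma]
        refine congrArg (M * ·) (Finset.sum_congr rfl fun m _ => ?_)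
        rw [Finset.sum_product, Finset.sum_mul_sum]

/-- **Weighted concatenation of bridges**: `Z^B_a(t) · Z^B_b(t) ≤ max(t,1/t) · Z^B_{a+b}(t)` (`t > 0`).
[cite: MadrasSlade1993, §1.2, eq. (1.2.15) (weighted by the bending fugacity, this file)] -/
theorem ZbendB_mul_le (a b : ℕ) {t : ℝ} (ht : 0 < t) :
    ZbendB a t * ZbendB b t ≤ max t t⁻¹ * ZbendB (a + b) t := by
  classical
  set M := max t t⁻¹ with hM
  have hM0 : 0 ≤ M := le_trans ht.le (le_max_left _ _)
  unfold ZbendB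
  rw [Finset.sum_mul_sum, ← Finset.sum_product']
  have hb : b = a + b - a := (Nat.add_sub_cancel_left a b).symm
  have hinj : Set.InjOn (fun p : (ℕ → Site 2) × (ℕ → Site 2) => concatWalk a p.1 p.2)
      ↑(bridges 2 a ×ˢ bridges 2 b) := by
    rintro ⟨η, τ⟩ hp ⟨η', τ'⟩ hp' h
    simp only [Finset.mem_coe, Finset.mem_product] at hp hp'
    obtain ⟨h1, h2⟩ := concatWalk_injective_pieces (mem_bridges.1 hp.1).1 (mem_bridges.1 hp.2).1
      (mem_bridges.1 hp'.1).1 (mem_bridges.1 hp'.2).1 h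
    subst h1 h2
    rfl
  have hsub : (bridges 2 a ×ˢ bridges 2 b).image (fun p : (ℕ → Site 2) × (ℕ → Site 2) => concatWalk a p.1 p.2) ⊆
      bridges 2 (a + b) := by
    intro ω hω
    obtain ⟨⟨η, τ⟩, hp, rfl⟩ := Finset.mem_image.1 hω
    obtain ⟨hη, hτ⟩ := Finset.mem_product.1 hp
    exact concatWalk_mem_bridges (Nat.le_add_right a b) hη (by rw [Nat.add_sub_cancel_left]; exact hτ)
  have hterm : ∀ p ∈ bridges 2 a ×ˢ bridges 2 b,
      t ^ turns a p.1 * t ^ turns b p.2 ≤ M * t ^ turns (a + b) (concatWalk a p.1 p.2) := by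
    rintro ⟨η, τ⟩ hp
    dsimp only
    simp only [Finset.mem_product] at hp
    obtain ⟨hη, hτ⟩ := hp
    have hηs := (mem_bridges.1 hη).1
    have hτs := (mem_bridges.1 hτ).1
    have hcs := (mem_bridges.1 (concatWalk_mem_bridges (Nat.le_add_right a b) hη
      (by rw [Nat.add_sub_cancel_left]; exact hτ))).1
    obtain ⟨h1, h2⟩ := turns_concatWalk_le_and_ge hηs hτs hcs
    have h := pow_le_maxInv_pow_mul_pow ht (c := 1) (a := turns a η + turns b τ)
      (b := turns (a + b) (concatWalk a η τ)) (by omega) (by omega)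
    rw [pow_one, pow_add] at h
    exact h
  calc ∑ p ∈ bridges 2 a ×ˢ bridges 2 b, t ^ turns a p.1 * t ^ turns b p.2
      ≤ ∑ p ∈ bridges 2 a ×ˢ bridges 2 b, M * t ^ turns (a + b) (concatWalk a p.1 p.2) := Finset.sum_le_sum hterm
    _ = M * ∑ ω ∈ (bridges 2 a ×ˢ bridges 2 b).image (fun p : (ℕ → Site 2) × (ℕ → Site 2) => concatWalk a p.1 p.2),
          t ^ turns (a + b) ω := by
        rw [Finset.mul_sum, Finset.sum_image hinj]
    _ ≤ M * ∑ ω ∈ bridges 2 (a + b), t ^ turns (a + b) ω := by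
        apply mul_le_mul_of_nonneg_left _ hM0
        exact Finset.sum_le_sum_of_subset_of_nonneg hsub fun _ _ _ => pow_nonneg ht.le _


/-! ### Assembly: `Z_n(t) ≤ (subexponential) · Z^B_{n+1}(t)` -/

/-- **Walks versus bridges with the bending weight**: for every `n` and `t > 0`,
`Z_n(t) ≤ (n+1) · M² · (M^{√(2(n+1))} e^{3√(n+1)})² · Z^B_{n+1}(t)`, `M = max(t, 1/t)` — Madras–Slade (3.1.7)
(`c_N ≤ (N+1) e^{O(√N)} b_{N+1}`) with the turn bookkeeping of this file.
[cite: MadrasSlade1993, §3.1, eq. (3.1.7) (weighted by the bending fugacity, this file)] -/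
theorem Zbend_le_mul_ZbendB_succ (n : ℕ) {t : ℝ} (ht : 0 < t) :
    Zbend n t ≤ ((n : ℝ) + 1) * max t t⁻¹ ^ 2 *
      (max t t⁻¹ ^ Real.sqrt (2 * ((n : ℝ) + 1)) * Real.exp (3 * Real.sqrt ((n : ℝ) + 1))) ^ 2 *
        ZbendB (n + 1) t := by
  set M := max t t⁻¹ with hM
  have hM1 : 1 ≤ M := by
    rcases le_or_gt 1 t with h | h
    · exact h.trans (le_max_left _ _)
    · exact (one_le_inv₀ ht |>.2 h.le).trans (le_max_right _ _)
  have hM0 : 0 ≤ M := zero_le_one.trans hM1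
  set A : ℝ := M ^ Real.sqrt (2 * ((n : ℝ) + 1)) * Real.exp (3 * Real.sqrt ((n : ℝ) + 1)) with hA
  have hA0 : 0 ≤ A := mul_nonneg (Real.rpow_nonneg hM0 _) (Real.exp_nonneg _)
  have hZB0 : ∀ k, 0 ≤ ZbendB k t := fun k => Finset.sum_nonneg fun _ _ => pow_nonneg ht.le _
  -- each half-space sum is at most `A · Z^B`
  have hZH : ∀ k, k ≤ n + 1 → ∑ ω ∈ halfSpaceWalks 2 k, t ^ turns k ω ≤ A * ZbendB k t := by
    intro k hk
    have h := sum_halfSpace_pow_turns_le k ht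
    have hk' : (k : ℝ) ≤ (n : ℝ) + 1 := by exact_mod_cast hk
    have h1 : M ^ Real.sqrt (2 * (k : ℝ)) ≤ M ^ Real.sqrt (2 * ((n : ℝ) + 1)) :=
      Real.rpow_le_rpow_of_exponent_le hM1 (Real.sqrt_le_sqrt (by linarith))
    have h2 : ((Literature.Combinatorics.Enumerative.finsetsOfSumLE k).card : ℝ) ≤
        Real.exp (3 * Real.sqrt ((n : ℝ) + 1)) :=
      (Literature.Combinatorics.Enumerative.card_finsetsOfSumLE_le_exp k).trans
        (Real.exp_le_exp.2 (by nlinarith [Real.sqrt_le_sqrt hk', Real.sqrt_nonneg (k : ℝ)]))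
    refine h.trans ?_
    have : M ^ Real.sqrt (2 * (k : ℝ)) * ((Literature.Combinatorics.Enumerative.finsetsOfSumLE k).card : ℝ) ≤ A :=
      mul_le_mul h1 h2 (Nat.cast_nonneg _) (Real.rpow_nonneg hM0 _)
    exact mul_le_mul_of_nonneg_right this (hZB0 k)
  have h1 := Zbend_le_sum_halfSpace n ht
  have h2 : ∑ m ∈ Finset.range (n + 1),
      (∑ ω ∈ halfSpaceWalks 2 (m + 1), t ^ turns (m + 1) ω) * ∑ ω ∈ halfSpaceWalks 2 (n - m), t ^ turns (n - m) ω ≤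
      ∑ m ∈ Finset.range (n + 1), A ^ 2 * (M * ZbendB (n + 1) t) := by
    refine Finset.sum_le_sum fun m hm => ?_
    rw [Finset.mem_range] at hm
    have ha := hZH (m + 1) (by omega)
    have hb := hZH (n - m) (by omega)
    have hc := ZbendB_mul_le (m + 1) (n - m) ht
    rw [show m + 1 + (n - m) = n + 1 by omega] at hc
    have hH0 : 0 ≤ ∑ ω ∈ halfSpaceWalks 2 (n - m), t ^ turns (n - m) ω :=
      Finset.sum_nonneg fun _ _ => pow_nonneg ht.le _
    calc (∑ ω ∈ halfSpaceWalks 2 (m + 1), t ^ turns (m + 1) ω) * ∑ ω ∈ halfSpaceWalks 2 (n - m), t ^ turns (n - m) ω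
        ≤ (A * ZbendB (m + 1) t) * (A * ZbendB (n - m) t) :=
          mul_le_mul ha hb hH0 (mul_nonneg hA0 (hZB0 _))
      _ = A ^ 2 * (ZbendB (m + 1) t * ZbendB (n - m) t) := by ring
      _ ≤ A ^ 2 * (M * ZbendB (n + 1) t) := mul_le_mul_of_nonneg_left hc (pow_nonneg hA0 2)
  rw [Finset.sum_const, Finset.card_range, nsmul_eq_mul] at h2
  calc Zbend n t ≤ M * ∑ m ∈ Finset.range (n + 1),
        (∑ ω ∈ halfSpaceWalks 2 (m + 1), t ^ turns (m + 1) ω) *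
          ∑ ω ∈ halfSpaceWalks 2 (n - m), t ^ turns (n - m) ω := h1
    _ ≤ M * (((n + 1 : ℕ) : ℝ) * (A ^ 2 * (M * ZbendB (n + 1) t))) := mul_le_mul_of_nonneg_left h2 hM0
    _ = ((n : ℝ) + 1) * M ^ 2 * A ^ 2 * ZbendB (n + 1) t := by push_cast; ring

/-! ### F2: bridges have the same bending free energy -/

/-- `Z^B_N(t) ≥ 1` for `t > 0` (the straight walk is a bridge with no turn). [cite: MadrasSlade1993, §1.2] -/
theorem one_le_ZbendB (N : ℕ) {t : ℝ} (ht : 0 < t) : 1 ≤ ZbendB N t := by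
  unfold ZbendB
  have hsw : straightWalk 2 N ∈ bridges 2 N := by
    refine mem_bridges.2 ⟨straightWalk_mem_saws 2 N, fun i h1 h2 => ?_⟩
    simp only [straightWalk, Pi.single_eq_same, min_eq_left h2, min_self, Nat.zero_min, Nat.cast_zero]
    exact ⟨by exact_mod_cast h1, by exact_mod_cast h2⟩
  have h := Finset.single_le_sum (f := fun ω : ℕ → Site 2 => t ^ turns N ω) (fun ω _ => pow_nonneg ht.le _) hsw
  simpa [turns_straightWalk] using h

/-- `Z^B_N(t) ≤ Z_N(t)` (bridges are self-avoiding walks). [cite: MadrasSlade1993, §1.2] -/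
theorem ZbendB_le_Zbend (N : ℕ) {t : ℝ} (ht : 0 < t) : ZbendB N t ≤ Zbend N t := by
  unfold ZbendB Zbend
  exact Finset.sum_le_sum_of_subset_of_nonneg (fun ω hω => (mem_bridges.1 hω).1) fun _ _ _ => pow_nonneg ht.le _

/-- The subexponential factor of `Zbend_le_mul_ZbendB_succ` is negligible on the scale `N`:
`log((n+1) M² (M^{√(2(n+1))} e^{3√(n+1)})²)/(n+1) → 0`. [cite: MadrasSlade1993, Corollary 3.1.6 (the e^{O(√N)} factor is subexponential)] -/
theorem tendsto_log_subexpFactor_div {M : ℝ} (hM : 0 < M) :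
    Tendsto (fun n : ℕ => Real.log (((n : ℝ) + 1) * M ^ 2 *
        (M ^ Real.sqrt (2 * ((n : ℝ) + 1)) * Real.exp (3 * Real.sqrt ((n : ℝ) + 1))) ^ 2) / ((n : ℝ) + 1))
      atTop (𝓝 0) := by
  -- the three elementary null sequences
  have hN : Tendsto (fun n : ℕ => (n : ℝ) + 1) atTop atTop :=
    tendsto_atTop_add_const_right _ 1 tendsto_natCast_atTop_atTop
  have ha : Tendsto (fun n : ℕ => 1 / ((n : ℝ) + 1)) atTop (𝓝 0) := tendsto_one_div_add_atTop_nhds_zero_nat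
  have hb : Tendsto (fun n : ℕ => Real.log ((n : ℝ) + 1) / ((n : ℝ) + 1)) atTop (𝓝 0) := by
    have h := (Real.tendsto_pow_log_div_mul_add_atTop 1 0 1 one_ne_zero).comp hN
    refine h.congr fun n => ?_
    simp
  have hc : Tendsto (fun n : ℕ => Real.sqrt ((n : ℝ) + 1) / ((n : ℝ) + 1)) atTop (𝓝 0) := by
    have h := (tendsto_rpow_neg_atTop (by norm_num : (0 : ℝ) < 1 / 2)).comp hN
    refine h.congr fun n => ?_
    have hn : (0 : ℝ) < (n : ℝ) + 1 := by positivity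
    simp only [Function.comp]
    rw [Real.sqrt_eq_rpow, show (-(1 / 2) : ℝ) = 1 / 2 - 1 by norm_num, Real.rpow_sub hn, Real.rpow_one]
  -- expand the logarithm
  have key : ∀ n : ℕ, Real.log (((n : ℝ) + 1) * M ^ 2 *
      (M ^ Real.sqrt (2 * ((n : ℝ) + 1)) * Real.exp (3 * Real.sqrt ((n : ℝ) + 1))) ^ 2) / ((n : ℝ) + 1) =
      Real.log ((n : ℝ) + 1) / ((n : ℝ) + 1) + 2 * Real.log M * (1 / ((n : ℝ) + 1)) +
        (2 * Real.sqrt 2 * Real.log M + 6) * (Real.sqrt ((n : ℝ) + 1) / ((n : ℝ) + 1)) := by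
    intro n
    have hn : (0 : ℝ) < (n : ℝ) + 1 := by positivity
    have hMs : 0 < M ^ Real.sqrt (2 * ((n : ℝ) + 1)) := Real.rpow_pos_of_pos hM _
    have he : 0 < Real.exp (3 * Real.sqrt ((n : ℝ) + 1)) := Real.exp_pos _
    rw [Real.log_mul (by positivity) (by positivity), Real.log_mul hn.ne' (by positivity), Real.log_pow,
      Real.log_pow, Real.log_mul hMs.ne' he.ne', Real.log_rpow hM, Real.log_exp,
      Real.sqrt_mul' 2 hn.le]
    push_cast
    field_simp
    ring
  simp_rw [key]
  have := (hb.add (ha.const_mul (2 * Real.log M))).add (hc.const_mul (2 * Real.sqrt 2 * Real.log M + 6))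
  simpa using this

/-- **F2 — bridges have the same bending free energy (lane «STIFF», `BendFE_bridges`)**: for every `t > 0`,
`log Z^B_N(t)/N → κ(t)`. Upper bound: `Z^B ≤ Z` and F1. Lower bound: the weighted Hammersley–Welsh chain
`Z_{N}(t) ≤ e^{o(N)} Z^B_{N+1}(t)` of this file. [cite: MadrasSlade1993, Corollary 3.1.6 (weighted by the bending fugacity, this file)] -/
theorem tendsto_log_ZbendB_div {t : ℝ} (ht : 0 < t) :
    Tendsto (fun N : ℕ => Real.log (ZbendB N t) / N) atTop (𝓝 (bendFE t)) := by
  set M := max t t⁻¹ with hM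
  have hMpos : 0 < M := lt_of_lt_of_le ht (le_max_left _ _)
  set K : ℕ → ℝ := fun n => ((n : ℝ) + 1) * M ^ 2 *
      (M ^ Real.sqrt (2 * ((n : ℝ) + 1)) * Real.exp (3 * Real.sqrt ((n : ℝ) + 1))) ^ 2 with hK
  have hKpos : ∀ n, 0 < K n := fun n => by
    have : 0 < M ^ Real.sqrt (2 * ((n : ℝ) + 1)) := Real.rpow_pos_of_pos hMpos _
    positivity
  have hZ : ∀ N, 0 < Zbend N t := fun N => Zbend_pos N ht
  have hZB : ∀ N, 0 < ZbendB N t := fun N => lt_of_lt_of_le one_pos (one_le_ZbendB N ht)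
  have hu := tendsto_log_Zbend_div ht
  -- shifted sequences
  have hu1 : Tendsto (fun N : ℕ => Real.log (Zbend (N + 1) t) / ((N : ℝ) + 1)) atTop (𝓝 (bendFE t)) := by
    have := (tendsto_add_atTop_iff_nat 1).2 hu
    refine this.congr fun N => ?_
    push_cast; rfl
  have hw : Tendsto (fun N : ℕ => (Real.log (Zbend N t) - Real.log (K N)) / ((N : ℝ) + 1)) atTop (𝓝 (bendFE t)) := by
    have h1 : Tendsto (fun N : ℕ => Real.log (Zbend N t) / N * ((N : ℝ) / ((N : ℝ) + 1))) atTop (𝓝 (bendFE t * 1)) :=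
      hu.mul (tendsto_natCast_div_add_atTop (1 : ℝ))
    rw [mul_one] at h1
    have h2 := tendsto_log_subexpFactor_div hMpos
    have h3 := h1.sub h2
    rw [sub_zero] at h3
    refine h3.congr' ?_
    filter_upwards [eventually_ge_atTop 1] with N hN
    have hN0 : (N : ℝ) ≠ 0 := by exact_mod_cast (show N ≠ 0 by omega)
    simp only [hK]
    field_simp
  refine (tendsto_add_atTop_iff_nat 1).1 ?_
  refine tendsto_of_tendsto_of_tendsto_of_le_of_le hw hu1 (fun N => ?_) (fun N => ?_)
  · -- lower: `log Z_N - log K_N ≤ log Z^B_{N+1}`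
    have hn : (0 : ℝ) < (N : ℝ) + 1 := by positivity
    have h := Zbend_le_mul_ZbendB_succ N ht
    have hlog : Real.log (Zbend N t) ≤ Real.log (K N) + Real.log (ZbendB (N + 1) t) := by
      rw [← Real.log_mul (hKpos N).ne' (hZB _).ne']
      exact Real.log_le_log (hZ N) h
    have : (Real.log (Zbend N t) - Real.log (K N)) / ((N : ℝ) + 1) ≤ Real.log (ZbendB (N + 1) t) / ((N : ℝ) + 1) :=
      div_le_div_of_nonneg_right (by linarith) hn.le
    simpa using this
  · -- upper: `Z^B ≤ Z`
    have hn : (0 : ℝ) < (N : ℝ) + 1 := by positivity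
    have hlog : Real.log (ZbendB (N + 1) t) ≤ Real.log (Zbend (N + 1) t) :=
      Real.log_le_log (hZB _) (ZbendB_le_Zbend (N + 1) ht)
    have : Real.log (ZbendB (N + 1) t) / ((N : ℝ) + 1) ≤ Real.log (Zbend (N + 1) t) / ((N : ℝ) + 1) :=
      div_le_div_of_nonneg_right hlog hn.le
    simpa using this

end Zd

end Literature.Probability.RandomPlanarGeometry.SAW

end
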